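import Summits.KontsevichZagierPeriods.KontsevichZagierPeriods.Theses.RootDecompQuadraticDescent
import Summits.KontsevichZagierPeriods.KontsevichZagierPeriods.Theorems.RootDecompQuadraticDescentDarkPairsEleven
import Literature.NumberTheory.Transcendental.KZCubeRationalMoves
import Literature.NumberTheory.Transcendental.KZFibreMapMove
import HarnessLib

/-!
(LANDED copy: lens-6 g8c `HOME/decomp-kz-lens-6/g8/ArctanFoldPairs.lean` sha256 187dfd5b1a743002, critic decomp-kz-crit-1 g2 CLEARED 2026-08-30T09:23:01Z; landing seat decomp-kz-census-1 g7 `--supports stmt-KontsevichZagierPeriods-28994`; generic docstrings added where the source had none.)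

# Census pairs #27 `[□²,1/(1−x+x²)] ≡ 2·[□²,1/(1+y+y²)]` and #30 `[□²,1/(1+x+y−2xy)] ≡ 2·[□²,1/(2+x+2y−2xy)]`
# decided inside `KZ.relations` (dyadic cut + reflections; for #27 ONE projective substitution `x = 3y/(2+y)`)

decomp-kz · lens 6 «barrier-complement carving» · generation 8 · second stretch file (addendum to
`SurdPairs.lean`, `ZetaTwoPairs.lean`, `NODE.md`).  Two instances of the conclusion of `DescentTwoQ`
(item 28994) / `KZDimTwo` (item 4280) of route `RootDecompQuadraticDescent`, decided ABSOLUTELY, for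
the census rows #27 (`INDEP/INDEP · known · UNEXPLAINED by folds`; values `2π/(3√3) = 2 · π/(3√3)`)
and #30 (`DILOG/DILOG · known · UNEXPLAINED by folds`): rules 1 + 2 only, dimension 2, no Stokes, no
transcendence input.  The reflection and subdivision moves are the TREE lemmas of
`Theorems/RootDecompQuadraticDescentDarkPairsEleven.lean` (`DarkPairs.rel_reflect_rep`,
`DarkPairs.rel_subdiv`, `DarkPairs.rel_fold`, `DarkPairs.rel_double`), imported, not restated.

## The chains
#27: `A = [□²,1/(1−x+x²)]`.  Dyadic subdivision along `x`: `A ≡ L + U`, `L = [□²,2/(4−2x+x²)]`,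
`U = [□²,2/(3+x²)]`; the reflection `x ↦ 1−x` gives `L ≡ U`; after relabelling `x ↔ y`
(`RFun.rel_rename`) the PROJECTIVE substitution `x = 3y/(2+y)` of `[0,1]` onto itself (rule 2,
Literature `KZ.of_sub_of_mem_relations_of_fibreMap`; `3 + (3y/(2+y))² = 12(1+y+y²)/(2+y)²`,
`dx = 6dy/(2+y)²`) gives `U ≡ [□²,1/(1+y+y²)] = B`.  Hence `A ≡ 2B`.  In angle terms the substitution
is `arctan(x/√3) = arctan((2y+1)/√3) − π/6`, a rotation by `π/6` of the conic `X² + 3 = 0` — the same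
mechanism as census #0 (g7, `y = x/(2−x)`, conic of discriminant −7); it lies OUTSIDE the depth-1
`PGL₂(ℚ)` list of prediction P4 (`κ = t/((1−λ)t+λ)` would need `λ = 1 = 1−λ`).
#30: `A = [□²,1/(1+x+y−2xy)]`, denominator `β + αx` with `α = 1−2y` changing sign, `β = 1+y`.  The cut
predicted in `NODE.md` P5 («one cut at ½») is in `x`, and it is DYADIC: `A ≡ L + U` with
`L = ½A(x/2,y) = [□²,1/(2+x+2y−2xy)] = B` on the nose and `U = ½A((1+x)/2,y) = [□²,1/(3+x−2xy)]
= B(1−x,1−y)` (central symmetry = two reflections); so `A ≡ 2B` by three moves — a fold the census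
fold-detector missed (it is the `log(φψ) = log φ + log ψ` splitting
`(2−y)/(1+y) = [3/(2+2y)]·[(4−2y)/3]` of the fibre integrals, realised by the cut at `x = ½`).

## Main results (namespace `Summit.KontsevichZagierPeriods.RootDecompQuadraticDescent.ArctanFold`)
* `pair27 : KZ.of A27.rep - 2 • KZ.of B27.rep ∈ KZ.relations`, `pair27'` (with `B27two = [□²,2/(1+y+y²)]`),
  `pair27_equivalent : KZ.Equivalent A27.rep B27two.rep`, `pair27_value`;
* `pair30 : KZ.of A30.rep - 2 • KZ.of B30.rep ∈ KZ.relations`, `pair30'`, `pair30_equivalent :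
  KZ.Equivalent A30.rep B30two.rep`, `pair30_value`;
* `arctanFold_decided`, `arctanFold_descentTwoQ_instances (R ⊇ KZ.relations)`, `arctanFold_of_kzDimTwo`
  (BY NAME over the born `KZDimTwo`); axioms `[propext, Classical.choice, Quot.sound]` (`#guard_msgs` pins).
-/

noncomputable section

open MeasureTheory Set MvPolynomial

namespace Summit.KontsevichZagierPeriods.RootDecompQuadraticDescent.ArctanFold

open Literature.NumberTheory.Transcendental
open Literature.NumberTheory.Transcendental.KZ
open Literature.ModelTheory.ExponentialFields (IsSemialgebraic)
open Summit.KontsevichZagierPeriods.RootDecompQuadraticDescent.DarkPairs (rel_reflect_rep rel_subdiv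
  rel_fold rel_double update_one_apply_zero)

/-! ## §1 Small `Fin` bookkeeping (verbatim from `SurdPairs.lean`) -/

/-- `snoc2_zero`: auxiliary theorem of the lens-6 g8c development ArctanFoldPairs (census pairs #27 #30; instances of 28994/4280) — see the module docstring; verbatim from the lens file. -/
@[simp] private theorem snoc2_zero (x : Fin 1 → ℝ) (t : ℝ) : (Fin.snoc x t : Fin 2 → ℝ) 0 = x 0 := rfl
/-- `snoc2_one`: auxiliary theorem of the lens-6 g8c development ArctanFoldPairs (census pairs #27 #30; instances of 28994/4280) — see the module docstring; verbatim from the lens file. -/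
@[simp] private theorem snoc2_one (x : Fin 1 → ℝ) (t : ℝ) : (Fin.snoc x t : Fin 2 → ℝ) 1 = t := rfl
/-- `init2_zero`: auxiliary theorem of the lens-6 g8c development ArctanFoldPairs (census pairs #27 #30; instances of 28994/4280) — see the module docstring; verbatim from the lens file. -/
@[simp] private theorem init2_zero (z : Fin 2 → ℝ) : Fin.init z 0 = z 0 := rfl
/-- `last_one_eq`: auxiliary theorem of the lens-6 g8c development ArctanFoldPairs (census pairs #27 #30; instances of 28994/4280) — see the module docstring; verbatim from the lens file. -/
private theorem last_one_eq : (Fin.last 1 : Fin 2) = 1 := rfl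
/-- `update_zero_apply_one`: auxiliary theorem of the lens-6 g8c development ArctanFoldPairs (census pairs #27 #30; instances of 28994/4280) — see the module docstring; verbatim from the lens file. -/
@[simp] private theorem update_zero_apply_one (x : Fin 2 → ℝ) (a : ℝ) : Function.update x 0 a 1 = x 1 :=
  Function.update_of_ne (by decide) a x

/-- A regular rational function gives a KZ-rational representation. [folklore] -/
private theorem isRational_rep {M : ℕ} (T : RFun M) : T.rep.IsRational :=
  ⟨T.num, T.den, T.den_ne, fun _ _ => rfl⟩

/-- The interval `[a, b]` as a subset of `ℝ¹`. -/
def ivl (a b : ℚ) : Set (Fin 1 → ℝ) := {y | (a : ℝ) ≤ y 0 ∧ y 0 ≤ b}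

/-- `mem_ivl`: auxiliary theorem of the lens-6 g8c development ArctanFoldPairs (census pairs #27 #30; instances of 28994/4280) — see the module docstring; verbatim from the lens file. -/
theorem mem_ivl {a b : ℚ} {y : Fin 1 → ℝ} : y ∈ ivl a b ↔ (a : ℝ) ≤ y 0 ∧ y 0 ≤ b := Iff.rfl

/-- `cube_eq_band`: auxiliary theorem of the lens-6 g8c development ArctanFoldPairs (census pairs #27 #30; instances of 28994/4280) — see the module docstring; verbatim from the lens file. -/
theorem cube_eq_band : cube 2 = KZlog.band (ivl 0 1) (fun _ => 0) fun _ => 1 := by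
  ext z
  rw [KZlog.mem_band, last_one_eq, mem_ivl, mem_cube, Fin.forall_fin_two]
  simp only [init2_zero, Rat.cast_zero, Rat.cast_one]

/-! ## §2 The data of census pair #27 -/

/-- `1 − x + x²` (census #27, first member; `x = x₀`). -/
def QA27 : MvPolynomial (Fin 2) ℚ := 1 - X 0 + X 0 ^ 2
/-- `1 + y + y²` (census #27, second member; `y = x₁`). -/
def QB27 : MvPolynomial (Fin 2) ℚ := 1 + X 1 + X 1 ^ 2
/-- `4 − 2x + x²` (lower dyadic half of `A27`, rescaled) and `3 + x²` (upper half). -/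
def QL27 : MvPolynomial (Fin 2) ℚ := 4 - 2 * X 0 + X 0 ^ 2
/-- `QU27`: auxiliary def of the lens-6 g8c development ArctanFoldPairs (census pairs #27 #30; instances of 28994/4280) — see the module docstring; verbatim from the lens file. -/
def QU27 : MvPolynomial (Fin 2) ℚ := 3 + X 0 ^ 2

/-- `QA27_pos`: auxiliary theorem of the lens-6 g8c development ArctanFoldPairs (census pairs #27 #30; instances of 28994/4280) — see the module docstring; verbatim from the lens file. -/
theorem QA27_pos (x : Fin 2 → ℝ) : 0 < aeval x QA27 := by
  simp only [QA27, map_add, map_sub, map_pow, map_one, aeval_X]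
  nlinarith [sq_nonneg (x 0 - 1 / 2)]
/-- `QB27_pos`: auxiliary theorem of the lens-6 g8c development ArctanFoldPairs (census pairs #27 #30; instances of 28994/4280) — see the module docstring; verbatim from the lens file. -/
theorem QB27_pos {x : Fin 2 → ℝ} (hx : x ∈ cube 2) : 0 < aeval x QB27 := by
  have h1 := (hx 1).1
  simp only [QB27, map_add, map_pow, map_one, aeval_X]
  nlinarith [sq_nonneg (x 1)]
/-- `QL27_pos`: auxiliary theorem of the lens-6 g8c development ArctanFoldPairs (census pairs #27 #30; instances of 28994/4280) — see the module docstring; verbatim from the lens file. -/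
theorem QL27_pos (x : Fin 2 → ℝ) : 0 < aeval x QL27 := by
  simp only [QL27, map_add, map_sub, map_mul, map_pow, map_ofNat, aeval_X]
  nlinarith [sq_nonneg (x 0 - 1)]
/-- `QU27_pos`: auxiliary theorem of the lens-6 g8c development ArctanFoldPairs (census pairs #27 #30; instances of 28994/4280) — see the module docstring; verbatim from the lens file. -/
theorem QU27_pos (x : Fin 2 → ℝ) : 0 < aeval x QU27 := by
  simp only [QU27, map_add, map_pow, map_ofNat, aeval_X]
  nlinarith [sq_nonneg (x 0)]

/-- `A27 = [□², 1/(1−x+x²)]`, `B27 = [□², 1/(1+y+y²)]`, `B27two = [□², 2/(1+y+y²)]`,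
`L27 = [□², 2/(4−2x+x²)]`, `U27 = [□², 2/(3+x²)]`. -/
def A27 : RFun 2 := ⟨1, QA27, fun x _ => (QA27_pos x).ne'⟩
/-- `B27`: auxiliary def of the lens-6 g8c development ArctanFoldPairs (census pairs #27 #30; instances of 28994/4280) — see the module docstring; verbatim from the lens file. -/
def B27 : RFun 2 := ⟨1, QB27, fun _ hx => (QB27_pos hx).ne'⟩
/-- `B27two`: auxiliary def of the lens-6 g8c development ArctanFoldPairs (census pairs #27 #30; instances of 28994/4280) — see the module docstring; verbatim from the lens file. -/
def B27two : RFun 2 := ⟨2, QB27, fun _ hx => (QB27_pos hx).ne'⟩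
/-- `L27`: auxiliary def of the lens-6 g8c development ArctanFoldPairs (census pairs #27 #30; instances of 28994/4280) — see the module docstring; verbatim from the lens file. -/
def L27 : RFun 2 := ⟨2, QL27, fun x _ => (QL27_pos x).ne'⟩
/-- `U27`: auxiliary def of the lens-6 g8c development ArctanFoldPairs (census pairs #27 #30; instances of 28994/4280) — see the module docstring; verbatim from the lens file. -/
def U27 : RFun 2 := ⟨2, QU27, fun x _ => (QU27_pos x).ne'⟩

/-! ## §3 The four moves -/

/-- (1) Dyadic subdivision along `x`: `A ≡ L + U`. -/
theorem step1 : KZ.of A27.rep - KZ.of L27.rep - KZ.of U27.rep ∈ KZ.relations := by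
  refine rel_subdiv 0 A27 L27 U27 (fun x _ => ?_) (fun x _ => ?_)
  · simp only [RFun.fn, L27, A27, QL27, QA27, map_add, map_sub, map_mul, map_pow, map_ofNat, map_one,
      aeval_X, Function.update_self]
    rw [show (1 : ℝ) - x 0 / 2 + (x 0 / 2) ^ 2 = (4 - 2 * x 0 + x 0 ^ 2) / 4 by ring, one_div_div]
    ring
  · simp only [RFun.fn, U27, A27, QU27, QA27, map_add, map_sub, map_pow, map_ofNat, map_one,
      aeval_X, Function.update_self]
    rw [show (1 : ℝ) - (1 + x 0) / 2 + ((1 + x 0) / 2) ^ 2 = (3 + x 0 ^ 2) / 4 by ring, one_div_div]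
    ring

/-- (2) Reflection `x ↦ 1 − x`: `L ≡ U`. -/
theorem step2 : KZ.of L27.rep - KZ.of U27.rep ∈ KZ.relations := by
  refine rel_reflect_rep 2 0 L27.rep U27.rep L27.isTameCube_rep U27.isTameCube_rep fun x hx => ?_
  have hq : (4 : ℝ) - 2 * x 0 + x 0 ^ 2 ≠ 0 := by nlinarith [sq_nonneg (x 0 - 1)]
  have hq' : (3 : ℝ) + (1 - x 0) ^ 2 ≠ 0 := by nlinarith [sq_nonneg (1 - x 0)]
  rw [RFun.rep_integrand, RFun.rep_integrand]
  simp only [RFun.fn, L27, U27, QL27, QU27, map_add, map_sub, map_mul, map_pow, map_ofNat, aeval_X,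
    Function.update_self]
  field_simp
  ring

/-- (3) Relabelling `x ↔ y`: `U ≡ U(y)`. -/
theorem step3 : KZ.of U27.rep - KZ.of (U27.rename (Equiv.swap 0 1)).rep ∈ KZ.relations :=
  RFun.rel_rename U27 (Equiv.swap 0 1)

/-- (4) The projective substitution `x = 3y/(2+y)` of `[0,1]` onto itself (fibrewise in the last
coordinate): `B ≡ U(y)`, since `2/(3 + (3y/(2+y))²) · 6/(2+y)² = 1/(1+y+y²)`. -/
theorem step4 : KZ.of B27.rep - KZ.of (U27.rename (Equiv.swap 0 1)).rep ∈ KZ.relations := by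
  have h2 : ∀ z ∈ cube 2, (0 : ℝ) < 2 + z 1 := fun z hz => by linarith [(hz 1).1]
  refine of_sub_of_mem_relations_of_fibreMap (G := ivl 0 1) (a := fun _ => 0) (b := fun _ => 1)
    (a' := fun _ => 0) (b' := fun _ => 1) (fun z => 3 * z 1 / (2 + z 1)) (fun z => 6 / (2 + z 1) ^ 2)
    B27.rep _ cube_eq_band cube_eq_band (fun _ _ => zero_le_one) ?_ ?_ ?_ ?_ ?_ ?_ ?_
  · refine (isSemialgebraicFunOn_aeval_div_aeval isSemialgebraic_cube
      (3 * X 1 : MvPolynomial (Fin 2) ℚ) (2 + X 1) fun z hz => ?_).congr fun z _ => ?_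
    · have h := h2 z hz
      simp only [map_add, map_ofNat, aeval_X]
      exact h.ne'
    · simp only [map_add, map_mul, map_ofNat, aeval_X]
  · intro z hz
    have hne := (h2 z hz).ne'
    fun_prop (disch := exact hne)
  · intro z hz
    have hne := (h2 z hz).ne'
    show HasDerivAt (fun t => 3 * (Fin.snoc (Fin.init z) t : Fin 2 → ℝ) 1 /
      (2 + (Fin.snoc (Fin.init z) t : Fin 2 → ℝ) 1)) _ (z 1)
    simp only [snoc2_one]
    have ha : HasDerivAt (fun t : ℝ => 3 * t) 3 (z 1) := by
      simpa using (hasDerivAt_id (z 1)).const_mul 3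
    have hb : HasDerivAt (fun t : ℝ => 2 + t) 1 (z 1) := by
      simpa using (hasDerivAt_id (z 1)).const_add 2
    exact (ha.div hb hne).congr_deriv (by field_simp; ring)
  · intro z hz
    exact div_pos (by norm_num) (pow_pos (h2 z hz) 2)
  · intro y _
    show 3 * (Fin.snoc y (0 : ℝ) : Fin 2 → ℝ) 1 / (2 + (Fin.snoc y (0 : ℝ) : Fin 2 → ℝ) 1) = 0
    simp
  · intro y _
    show 3 * (Fin.snoc y (1 : ℝ) : Fin 2 → ℝ) 1 / (2 + (Fin.snoc y (1 : ℝ) : Fin 2 → ℝ) 1) = 1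
    norm_num [snoc2_one]
  · intro z hz
    have hne := (h2 z hz).ne'
    have hq : (1 : ℝ) + z 1 + z 1 ^ 2 ≠ 0 := by nlinarith [sq_nonneg (z 1), (hz 1).1]
    rw [RFun.rep_integrand, RFun.rep_integrand, RFun.fn_rename]
    simp only [RFun.fn, B27, U27, QB27, QU27, map_add, map_pow, map_ofNat, map_one,
      aeval_X, Function.comp_apply, Equiv.swap_apply_left, snoc2_one]
    rw [show (3 : ℝ) + (3 * z 1 / (2 + z 1)) ^ 2 = 12 * (1 + z 1 + z 1 ^ 2) / (2 + z 1) ^ 2 by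
      field_simp; ring]
    field_simp
    ring

/-! ## §4a Census pair #27 DECIDED -/

/-- **Census pair #27 DECIDED**: `[□²,1/(1−x+x²)] − 2·[□²,1/(1+y+y²)] ∈ KZ.relations` (four moves of
rules 1 + 2: dyadic cut, reflection, relabelling, projective substitution `x = 3y/(2+y)`). -/
theorem pair27 : KZ.of A27.rep - 2 • KZ.of B27.rep ∈ KZ.relations := by
  have hBU : KZ.of B27.rep - KZ.of U27.rep ∈ KZ.relations := by
    have h := sub_mem step4 step3
    convert h using 1
    abel
  have hBL : KZ.of B27.rep - KZ.of L27.rep ∈ KZ.relations := by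
    have h := sub_mem hBU step2
    convert h using 1
    abel
  exact rel_fold A27 B27 L27 U27 step1 hBL hBU

/-- The same with the doubled integrand `B27two = [□², 2/(1+y+y²)]` (rule 1b). -/
theorem pair27' : KZ.of A27.rep - KZ.of B27two.rep ∈ KZ.relations := by
  have hd : KZ.of B27two.rep - 2 • KZ.of B27.rep ∈ KZ.relations :=
    rel_double B27 B27two fun x _ => by
      simp only [RFun.fn, B27, B27two, map_ofNat, map_one]
      ring
  have h := sub_mem pair27 hd
  convert h using 1
  abel

/-- `pair27_equivalent`: auxiliary theorem of the lens-6 g8c development ArctanFoldPairs (census pairs #27 #30; instances of 28994/4280) — see the module docstring; verbatim from the lens file. -/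
theorem pair27_equivalent : KZ.Equivalent A27.rep B27two.rep := pair27'

/-- `pair27_value`: auxiliary theorem of the lens-6 g8c development ArctanFoldPairs (census pairs #27 #30; instances of 28994/4280) — see the module docstring; verbatim from the lens file. -/
theorem pair27_value : A27.rep.value = B27two.rep.value :=
  KZ.Equivalent.value_eq_holds pair27_equivalent

/-! ## §4b Census pair #30: a dyadic fold with central symmetry -/

/-- `1 + x + y − 2xy` (census #30, first member), `2 + x + 2y − 2xy` (second member),
`3 + x − 2xy` (upper dyadic half of `A30`, rescaled) and its `x`-reflection `4 − x − 2y + 2xy`. -/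
def QA30 : MvPolynomial (Fin 2) ℚ := 1 + X 0 + X 1 - 2 * X 0 * X 1
/-- `QB30`: auxiliary def of the lens-6 g8c development ArctanFoldPairs (census pairs #27 #30; instances of 28994/4280) — see the module docstring; verbatim from the lens file. -/
def QB30 : MvPolynomial (Fin 2) ℚ := 2 + X 0 + 2 * X 1 - 2 * X 0 * X 1
/-- `QU30`: auxiliary def of the lens-6 g8c development ArctanFoldPairs (census pairs #27 #30; instances of 28994/4280) — see the module docstring; verbatim from the lens file. -/
def QU30 : MvPolynomial (Fin 2) ℚ := 3 + X 0 - 2 * X 0 * X 1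
/-- `QV30`: auxiliary def of the lens-6 g8c development ArctanFoldPairs (census pairs #27 #30; instances of 28994/4280) — see the module docstring; verbatim from the lens file. -/
def QV30 : MvPolynomial (Fin 2) ℚ := 4 - X 0 - 2 * X 1 + 2 * X 0 * X 1

/-- `QA30_pos`: auxiliary theorem of the lens-6 g8c development ArctanFoldPairs (census pairs #27 #30; instances of 28994/4280) — see the module docstring; verbatim from the lens file. -/
theorem QA30_pos {x : Fin 2 → ℝ} (hx : x ∈ cube 2) : 0 < aeval x QA30 := by
  have h0 := hx 0; have h1 := hx 1
  simp only [QA30, map_add, map_sub, map_mul, map_ofNat, map_one, aeval_X]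
  nlinarith [mul_nonneg h0.1 (sub_nonneg.2 h1.2), mul_nonneg h1.1 (sub_nonneg.2 h0.2)]
/-- `QB30_pos`: auxiliary theorem of the lens-6 g8c development ArctanFoldPairs (census pairs #27 #30; instances of 28994/4280) — see the module docstring; verbatim from the lens file. -/
theorem QB30_pos {x : Fin 2 → ℝ} (hx : x ∈ cube 2) : 0 < aeval x QB30 := by
  have h0 := hx 0; have h1 := hx 1
  simp only [QB30, map_add, map_sub, map_mul, map_ofNat, aeval_X]
  nlinarith [mul_nonneg h1.1 (sub_nonneg.2 h0.2)]
/-- `QU30_pos`: auxiliary theorem of the lens-6 g8c development ArctanFoldPairs (census pairs #27 #30; instances of 28994/4280) — see the module docstring; verbatim from the lens file. -/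
theorem QU30_pos {x : Fin 2 → ℝ} (hx : x ∈ cube 2) : 0 < aeval x QU30 := by
  have h0 := hx 0; have h1 := hx 1
  simp only [QU30, map_add, map_sub, map_mul, map_ofNat, aeval_X]
  nlinarith [mul_nonneg h0.1 h1.1, mul_nonneg (sub_nonneg.2 h0.2) h1.1]
/-- `QV30_pos`: auxiliary theorem of the lens-6 g8c development ArctanFoldPairs (census pairs #27 #30; instances of 28994/4280) — see the module docstring; verbatim from the lens file. -/
theorem QV30_pos {x : Fin 2 → ℝ} (hx : x ∈ cube 2) : 0 < aeval x QV30 := by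
  have h0 := hx 0; have h1 := hx 1
  simp only [QV30, map_add, map_sub, map_mul, map_ofNat, aeval_X]
  nlinarith [mul_nonneg h1.1 (sub_nonneg.2 h0.2), mul_nonneg h0.1 h1.1]

/-- `A30 = [□²,1/(1+x+y−2xy)]`, `B30 = [□²,1/(2+x+2y−2xy)]`, `B30two = [□²,2/(2+x+2y−2xy)]`,
`U30 = [□²,1/(3+x−2xy)]`, `V30 = [□²,1/(4−x−2y+2xy)]`. -/
def A30 : RFun 2 := ⟨1, QA30, fun _ hx => (QA30_pos hx).ne'⟩
/-- `B30`: auxiliary def of the lens-6 g8c development ArctanFoldPairs (census pairs #27 #30; instances of 28994/4280) — see the module docstring; verbatim from the lens file. -/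
def B30 : RFun 2 := ⟨1, QB30, fun _ hx => (QB30_pos hx).ne'⟩
/-- `B30two`: auxiliary def of the lens-6 g8c development ArctanFoldPairs (census pairs #27 #30; instances of 28994/4280) — see the module docstring; verbatim from the lens file. -/
def B30two : RFun 2 := ⟨2, QB30, fun _ hx => (QB30_pos hx).ne'⟩
/-- `U30`: auxiliary def of the lens-6 g8c development ArctanFoldPairs (census pairs #27 #30; instances of 28994/4280) — see the module docstring; verbatim from the lens file. -/
def U30 : RFun 2 := ⟨1, QU30, fun _ hx => (QU30_pos hx).ne'⟩
/-- `V30`: auxiliary def of the lens-6 g8c development ArctanFoldPairs (census pairs #27 #30; instances of 28994/4280) — see the module docstring; verbatim from the lens file. -/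
def V30 : RFun 2 := ⟨1, QV30, fun _ hx => (QV30_pos hx).ne'⟩

/-- (1) Dyadic subdivision along `x`: `A ≡ B + U` — the lower half IS `B`. -/
theorem s30_1 : KZ.of A30.rep - KZ.of B30.rep - KZ.of U30.rep ∈ KZ.relations := by
  refine rel_subdiv 0 A30 B30 U30 (fun x _ => ?_) (fun x _ => ?_)
  · simp only [RFun.fn, B30, A30, QB30, QA30, map_add, map_sub, map_mul, map_ofNat, map_one, aeval_X,
      Function.update_self, update_zero_apply_one]
    rw [show (1 : ℝ) + x 0 / 2 + x 1 - 2 * (x 0 / 2) * x 1 = (2 + x 0 + 2 * x 1 - 2 * x 0 * x 1) / 2 by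
      ring, one_div_div]
    ring
  · simp only [RFun.fn, U30, A30, QU30, QA30, map_add, map_sub, map_mul, map_ofNat, map_one, aeval_X,
      Function.update_self, update_zero_apply_one]
    rw [show (1 : ℝ) + (1 + x 0) / 2 + x 1 - 2 * ((1 + x 0) / 2) * x 1 = (3 + x 0 - 2 * x 0 * x 1) / 2 by
      ring, one_div_div]
    ring

/-- (2) Reflection `x ↦ 1 − x`: `U ≡ V`. -/
theorem s30_2 : KZ.of U30.rep - KZ.of V30.rep ∈ KZ.relations := by
  refine rel_reflect_rep 2 0 U30.rep V30.rep U30.isTameCube_rep V30.isTameCube_rep fun x _ => ?_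
  rw [RFun.rep_integrand, RFun.rep_integrand]
  simp only [RFun.fn, U30, V30, QU30, QV30, map_add, map_sub, map_mul, map_ofNat, map_one, aeval_X,
    Function.update_self, update_zero_apply_one]
  rw [show (4 : ℝ) - (1 - x 0) - 2 * x 1 + 2 * (1 - x 0) * x 1 = 3 + x 0 - 2 * x 0 * x 1 by ring]

/-- (3) Reflection `y ↦ 1 − y`: `V ≡ B`. -/
theorem s30_3 : KZ.of V30.rep - KZ.of B30.rep ∈ KZ.relations := by
  refine rel_reflect_rep 2 1 V30.rep B30.rep V30.isTameCube_rep B30.isTameCube_rep fun x _ => ?_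
  rw [RFun.rep_integrand, RFun.rep_integrand]
  simp only [RFun.fn, V30, B30, QV30, QB30, map_add, map_sub, map_mul, map_ofNat, map_one, aeval_X,
    Function.update_self, update_one_apply_zero]
  rw [show (2 : ℝ) + x 0 + 2 * (1 - x 1) - 2 * x 0 * (1 - x 1) = 4 - x 0 - 2 * x 1 + 2 * x 0 * x 1 by
    ring]

/-- **Census pair #30 DECIDED**: `[□²,1/(1+x+y−2xy)] − 2·[□²,1/(2+x+2y−2xy)] ∈ KZ.relations` (three
moves of rules 1 + 2: dyadic cut along `x`, reflections in `x` and in `y`). -/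
theorem pair30 : KZ.of A30.rep - 2 • KZ.of B30.rep ∈ KZ.relations := by
  have hBU : KZ.of B30.rep - KZ.of U30.rep ∈ KZ.relations := by
    have h := neg_mem (add_mem s30_2 s30_3)
    convert h using 1
    abel
  have hBB : KZ.of B30.rep - KZ.of B30.rep ∈ KZ.relations := by
    rw [sub_self]; exact zero_mem _
  exact rel_fold A30 B30 B30 U30 s30_1 hBB hBU

/-- The same with the doubled integrand `B30two = [□², 2/(2+x+2y−2xy)]` (rule 1b). -/
theorem pair30' : KZ.of A30.rep - KZ.of B30two.rep ∈ KZ.relations := by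
  have hd : KZ.of B30two.rep - 2 • KZ.of B30.rep ∈ KZ.relations :=
    rel_double B30 B30two fun x _ => by
      simp only [RFun.fn, B30, B30two, map_ofNat, map_one]
      ring
  have h := sub_mem pair30 hd
  convert h using 1
  abel

/-- `pair30_equivalent`: auxiliary theorem of the lens-6 g8c development ArctanFoldPairs (census pairs #27 #30; instances of 28994/4280) — see the module docstring; verbatim from the lens file. -/
theorem pair30_equivalent : KZ.Equivalent A30.rep B30two.rep := pair30'

/-- `pair30_value`: auxiliary theorem of the lens-6 g8c development ArctanFoldPairs (census pairs #27 #30; instances of 28994/4280) — see the module docstring; verbatim from the lens file. -/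
theorem pair30_value : A30.rep.value = B30two.rep.value :=
  KZ.Equivalent.value_eq_holds pair30_equivalent

/-! ## §5 Packaging: the pairs as DECIDED INSTANCES of the route items -/

open Summit.KontsevichZagierPeriods.KontsevichZagierPeriods.Theses.RootDecompQuadraticDescent (KZDimTwo)

/-- Census pairs #27 and #30 are decided instances of the n = m = 2 case: both members KZ-rational,
equal values, and EQUIVALENT — the conclusion of `KZDimTwo` (item 4280) holds for them outright. -/
theorem arctanFold_decided :
    (A27.rep.IsRational ∧ B27two.rep.IsRational ∧ A27.rep.value = B27two.rep.value ∧
      KZ.Equivalent A27.rep B27two.rep) ∧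
    (A30.rep.IsRational ∧ B30two.rep.IsRational ∧ A30.rep.value = B30two.rep.value ∧
      KZ.Equivalent A30.rep B30two.rep) :=
  ⟨⟨isRational_rep _, isRational_rep _, pair27_value, pair27_equivalent⟩,
   ⟨isRational_rep _, isRational_rep _, pair30_value, pair30_equivalent⟩⟩

/-- For every `R ⊇ KZ.relations` (in particular every two-sided-absorbing subgroup of the descent
items) the #27 and #30 differences lie in `R`: instances of the conclusion of `DescentTwoQ`
(item 28994) with NO use of its oracle hypotheses. -/
theorem arctanFold_descentTwoQ_instances (R : AddSubgroup KZ.FormalRep) (hR : KZ.relations ≤ R) :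
    KZ.of A27.rep - 2 • KZ.of B27.rep ∈ R ∧ KZ.of A27.rep - KZ.of B27two.rep ∈ R ∧
      KZ.of A30.rep - 2 • KZ.of B30.rep ∈ R ∧ KZ.of A30.rep - KZ.of B30two.rep ∈ R :=
  ⟨hR pair27, hR pair27', hR pair30, hR pair30'⟩

/-- … and, trivially, `KZDimTwo` (the born route decl, BY NAME) implies the equivalences too. -/
theorem arctanFold_of_kzDimTwo (h : KZDimTwo) :
    KZ.Equivalent A27.rep B27two.rep ∧ KZ.Equivalent A30.rep B30two.rep :=
  ⟨h le_rfl le_rfl _ _ (isRational_rep _) (isRational_rep _) pair27_value,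
   h le_rfl le_rfl _ _ (isRational_rep _) (isRational_rep _) pair30_value⟩

/-- info: 'Summit.KontsevichZagierPeriods.RootDecompQuadraticDescent.ArctanFold.pair27' depends on axioms: [propext,
 Classical.choice,
 Quot.sound] -/
#guard_msgs in #print axioms pair27

/-- info: 'Summit.KontsevichZagierPeriods.RootDecompQuadraticDescent.ArctanFold.pair30' depends on axioms: [propext,
 Classical.choice,
 Quot.sound] -/
#guard_msgs in #print axioms pair30

/-- info: 'Summit.KontsevichZagierPeriods.RootDecompQuadraticDescent.ArctanFold.arctanFold_decided' depends on axioms: [propext,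
 Classical.choice,
 Quot.sound] -/
#guard_msgs in #print axioms arctanFold_decided

/-- info: 'Summit.KontsevichZagierPeriods.RootDecompQuadraticDescent.ArctanFold.arctanFold_of_kzDimTwo' depends on axioms: [propext,
 Classical.choice,
 Quot.sound] -/
#guard_msgs in #print axioms arctanFold_of_kzDimTwo

end Summit.KontsevichZagierPeriods.RootDecompQuadraticDescent.ArctanFold

end
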